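/-
COR-CM (cell pub-hodgecm2, stage 2 of the Hodge ladder) — junction B01, leaf B01-O: the joint theta-pinned end display of the x1
lane in MEETING form over `Model.embOf` (`CorCM/B01/FaceWedgeMeetJointMeeting.lean`, p292271 — the PORT SOCKET of record for the
O side: tgtbt-1 ruling (i) 2026-08-21T18:28Z «consumed decl `Model.hc_cm_of_jointThetaPin_meeting_rec` :172»; own-b01 B01-O STATE v2
(f); b01-idea-1 IDEA-1v §3) with its TRANSLATE-CLOSURE clause in the LEVEL-PINNED EXISTENCE SHAPE `Transposition.Model.LiftTranslate`
of `Transposition/Item6HeckeTranslateClosed.lean` (p281684, item6-p4; OFFER HOME/INBOX l.4633), so that EVERY clause of the ONE per-face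
hypothesis is shaped like one stage-1 package input: `S` ↔ theta supply (`Theta`, `Theta_sub`, `Open_supply`), `LiftTranslate` ↔
`BallFacts.transl`, `Siso` ↔ the isolation INSTANCE (`core`, `t12`, `t34`, `H_chars`, `H_occ`), C5′ `gen12Meet` ↔ `h₇`, C6′ `real34Meet` ↔
`h₈ = Real34MeetAt` of `ModelAxiomsPerL.nonempty_thetaRealisation₂_at` (PKG `HodgeCM/Model/EndStateMeet.lean`:353).  AUTHORED AND FILED by
seat prover-pub-hodgecm2-b01-x1-g3-0 (b01-x1 gen 3), 2026-08-21 (lane `CorCM/B01/FaceWedgeMeet*.lean`, lead NAMING RULING l.4194 (3), ACK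
l.4771 (b)).  Theorems only: no `def`, no instance, no cite binder, nothing cited as a record, nothing asserted, no `sorry`; `Interfaces.lean`
(C1), the E term, `Transposition/*` and the other `CorCM/B01/*` files untouched.
WHY THE MEETING BASE (not the clause-per-lane base p296136): clause (3) of p296136 — the CLOSURE-SPAN (generator) form of `Real34`
relative to `Model.embOf` — is the HAZARD CLASS C6 of the package's own analysis (PKG `Model/EndStateMeet.lean` ll. 18–29: «false for
the genuine core as soon as the class group of the torus is non-trivial» for a PIECE-SUPPORTED `emb`, which `Model.embOf` is —
`Transposition/Item3EmbOf.lean`:375 `embOf_apply_pieceLiftLp`; b01-idea-1 IDEA-1v §3, HOME/INBOX l.4777): inhabitable at `U_rec` only by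
non-genuine («junk») settings, hence not a port socket.  The meeting form C6′ `real34Meet` is what PerL Thm 4.4 consumes and what the
package discharges.
T5 (standing tribunal item, COORDINATOR RULING 2026-08-21T15:33:56Z (3)): the per-face binder set of the displays below was submitted to
pub-hodgecm2-t5-consist-1 on the exact bytes before filing (HOME/INBOX; verdict line in HOME/T5-LEDGER.md, quoted in the filing note).
FRAMING (COORDINATOR RULING 2026-08-21T11:55:35Z): `HC_CM` is NOT proved; B01-O is NOT proved; the per-face binder `h` below is OPEN in the
tree at a general face and inhabited by no one.
-/
import Summits.HodgeConjecture.CorCM.B01.FaceWedgeMeetJointMeeting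
import Summits.HodgeConjecture.CorCM.B01.Transposition.Item6HeckeTranslateClosed
import HarnessLib

/-!
# B01-O, joint theta-pinned MEETING display with the translate clause in LIFT form (`LiftTranslate`)

In `Model.hc_cm_of_jointThetaPin_meeting[_rec]` (`FaceWedgeMeetJointMeeting.lean`:133/:172) clause (1) of the per-face hypothesis is
the COHOMOLOGICAL translate-closure `S.TranslateClosed (Transposition.Model.heckeFamily …)` («`g^* η ∈ Θ_i(Γ')` for every morphism `g` of
the honest Hecke family»), a statement the stage-1 package never typed.  `Transposition/Item6HeckeTranslateClosed.lean` (p281684)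
derives it on the model universe from the level-pinned EXISTENCE shape `Transposition.Model.LiftTranslate hHD hI h₁ h₃ Θ T hT` (:105; «for
`γ ∈ U(V₃,h)(L)`, `Γ' ≤ Γ.heckePair γ`, `η ∈ Θ Γ` SOME `η' ∈ Θ Γ'` has holomorphic lift `γ̂^*(lift η)` in the Sylvester frames of ONE
matrix `T` of `V` at `ι₁`»; cf. the package's `BallFacts.transl`, `HodgeCM/Automorphic/ThetaWedgeSplit.lean`:161, whose target level is
existential) by `Transposition.Model.translateClosed_heckeFamily_of_liftTranslate (hL : 2 < [L:ℚ]) S hΘ` (:157).  This file displays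
the MEETING end term with clause (1) REPLACED by the data `(T, hT)` and `∀ i : Fin 4, LiftTranslate … (S.Theta i) T hT`:

* `Model.exists_periodNV_free_of_jointThetaPin_lift (hHD hI h₁ h₃) (h)` — free face-period witnesses;
* `Model.hc_cm_of_jointThetaPin_lift (hHD hI h₁ h₃) (hR) (h) : HC_CM`;
* `Model.hc_cm_of_jointThetaPin_lift_rec (h) : HC_CM` on the universe OF RECORD — ONE hypothesis.

Per-face binders of `h` (∃ `ι₁ V σ`): DATA `S : Transposition.FaceThetaSupply U ι₁ V F f.psi σ` [S2: `Theta`, `Theta_sub`, `supply`] · DATA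
`T, hT` (a Sylvester matrix of `V` at `ι₁`; one EXISTS, `Transposition.Model.exists_sylvesterMatrix`, so this is a CHOICE, not an
obligation) · DATA `Siso : Perl34.IsolationSetting H (Lp ℂ 2 V.autMeasure) …` [(v-S)] · (1ᴸ) `∀ i, LiftTranslate … (S.Theta i) T hT`
[(vi-3) Hecke stability in existence shape] · (2′) C5′ `gen12Meet` at the PINNED theta sets `S.Theta 0/1` [(v-g′)] · (3′) C6′ `real34Meet`
[(v-r′)].  NOT binders: item (iii) (`Model.embOf` p289518, `Model.embOf_inner_emb` p290113; no `cover`, no (β), no level-meeting clause —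
C6′ concludes at ONE level by itself), B01-H (p277416), Prop 3.6/Thm 3.7 (p277743, inside `IsolationSpans.periodNV_ofSetting_meet`
p280226), HR (2,0), the universe facts, Hom-fullness on `U_rec`.
STRENGTH: LIFT-MEET ⇒ JOINT-MEET of p292271 (clause (1ᴸ) ⇒ (1) by `translateClosed_heckeFamily_of_liftTranslate`, `2 < 6 ≤ [F:ℚ]`;
(2′), (3′) verbatim) ⇒ free face-period witnesses ⇒ `HC_CM`; the converse (1) ⇒ (1ᴸ) is NOT claimed.  Like every per-face display on
this path it is PeriodNV-strength with `Siso` un-pinned (idea-2 IDEA-2u, b28 §X7, x1 HOME/INBOX l.4543): it CLASSIFIES the open content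
clause by package input; it discharges nothing.
-/

noncomputable section

open scoped TensorProduct InnerProductSpace Matrix

namespace Summit.HodgeConjecture.CorCM

open MeasureTheory
open Literature.AlgebraicGeometry.Motives (CMType HodgeStructure)
open Literature.AlgebraicGeometry.Motives.HodgeStructure (conj)
open Literature.AlgebraicGeometry.HodgeTheory
open Literature.NumberTheory.Automorphic
open Literature.NumberTheory.Automorphic.PicardCM
open Literature.Geometry.ComplexHyperbolic
open Prior.Perl34File (Perl34.IsolationSetting)
open Prior.Perl34File.Perl34

namespace Model

open Transposition

/-- **Free face-period witnesses from the joint theta-pinned datum in MEETING form with the translate clause in LIFT form.**  Per Galois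
CM field `F` of degree `≥ 6` and face `f`, at SOME `(ι₁, V, σ)`: a theta supply datum `S`, a Sylvester matrix `T` of `V` at `ι₁`, the
existence-shape translate property `LiftTranslate` of the four theta-class families in the frames of `T`, an isolation setting `Siso` over
`L²([U(V)], autMeasure V)`, C5′ at the pinned theta sets and C6′ `real34Meet`, all read through `Model.embOf`.  Reduction to
`exists_periodNV_free_of_jointThetaPin_meeting`: clause (1) `TranslateClosed` is
`Transposition.Model.translateClosed_heckeFamily_of_liftTranslate` (`2 < 6 ≤ [F:ℚ]`). [folklore] -/
theorem exists_periodNV_free_of_jointThetaPin_lift (hHD : exists_isReal_hodgeModel)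
    (hI : hodgePQ_independent_of_hodgeModel) (h₁ : BallQuotientUniformised) (h₃ : CMAbelianVarietyRealised)
    (h : ∀ (F : CMField), IsGalois ℚ F → 6 ≤ Module.finrank ℚ F → ∀ f : Face F,
      ∃ (ι₁ : F →+* ℂ) (V : HermSpace3 F ι₁) (σ : F →+* ℂ)
        (S : FaceThetaSupply (picardCMUniverse hHD hI h₁ h₃) ι₁ V F f.psi σ)
        (T : GL (Fin 3) ℂ) (hT : (T : Matrix (Fin 3) (Fin 3) ℂ)ᴴ * V.Hm.map ι₁ * (T : Matrix (Fin 3) (Fin 3) ℂ) = BallModel.J)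
        (H CG G SK SigIdx SigIdxG : Type)
        (_ : NormedAddCommGroup H) (_ : InnerProductSpace ℂ H) (_ : CompleteSpace H)
        (_ : NormedAddCommGroup CG) (_ : NormedSpace ℂ CG) (_ : Group G) (_ : TopologicalSpace G) (_ : TopologicalSpace SK)
        (Siso : Perl34.IsolationSetting H (Lp ℂ 2 V.autMeasure) CG G SK SigIdx SigIdxG),
        (∀ i : Fin 4, Transposition.Model.LiftTranslate hHD hI h₁ h₃ (S.Theta i) T hT) ∧
        (∀ (Γ : Level V) (ω₁ ω₂ : (picardCMUniverse hHD hI h₁ h₃).CohC ((picardCMUniverse hHD hI h₁ h₃).pms F ι₁ V Γ) 1),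
          ω₁ ∈ S.Theta 0 Γ → ω₂ ∈ S.Theta 1 Γ →
          embOf hHD hI (ballQuotientUniformisedDatum_of h₁) h₃ Γ
              ((picardCMUniverse hHD hI h₁ h₃).cup2C ((picardCMUniverse hHD hI h₁ h₃).pms F ι₁ V Γ) 1 ω₁ ω₂) ≠ 0 →
            ∃ u ∈ Siso.t12.S12,
              ⟪embOf hHD hI (ballQuotientUniformisedDatum_of h₁) h₃ Γ
                  ((picardCMUniverse hHD hI h₁ h₃).cup2C ((picardCMUniverse hHD hI h₁ h₃).pms F ι₁ V Γ) 1 ω₁ ω₂), u⟫_ℂ ≠ 0) ∧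
        (∀ χ : Siso.t34.X, Siso.t34.allowed χ → ∀ (Φ : SK) (Γ₁ : Level V)
          (ω₁ ω₂ : (picardCMUniverse hHD hI h₁ h₃).CohC ((picardCMUniverse hHD hI h₁ h₃).pms F ι₁ V Γ₁) 1),
          ω₁ ∈ (picardCMUniverse hHD hI h₁ h₃).Uiso Γ₁ F (f.psi 0) σ →
          ω₂ ∈ (picardCMUniverse hHD hI h₁ h₃).Uiso Γ₁ F (f.psi 1) σ →
            ⟪embOf hHD hI (ballQuotientUniformisedDatum_of h₁) h₃ Γ₁
                ((picardCMUniverse hHD hI h₁ h₃).cup2C ((picardCMUniverse hHD hI h₁ h₃).pms F ι₁ V Γ₁) 1 ω₁ ω₂),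
              Siso.t34.ϑ χ Φ⟫_ℂ ≠ 0 →
              ∃ (Γ : Level V) (ω : Fin 4 → (picardCMUniverse hHD hI h₁ h₃).CohC ((picardCMUniverse hHD hI h₁ h₃).pms F ι₁ V Γ) 1),
                (∀ i, ω i ∈ (picardCMUniverse hHD hI h₁ h₃).Uiso Γ F (f.psi i) σ) ∧
                ⟪embOf hHD hI (ballQuotientUniformisedDatum_of h₁) h₃ Γ
                    ((picardCMUniverse hHD hI h₁ h₃).cup2C ((picardCMUniverse hHD hI h₁ h₃).pms F ι₁ V Γ) 1 (ω 2) (ω 3)),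
                  embOf hHD hI (ballQuotientUniformisedDatum_of h₁) h₃ Γ
                    ((picardCMUniverse hHD hI h₁ h₃).cup2C ((picardCMUniverse hHD hI h₁ h₃).pms F ι₁ V Γ) 1 (ω 0) (ω 1))⟫_ℂ
                  ≠ 0)) :
    ∀ (F : CMField), IsGalois ℚ F → 6 ≤ Module.finrank ℚ F → ∀ f : Face F,
      ∃ (ι₁ : F →+* ℂ) (V : HermSpace3 F ι₁) (σ : F →+* ℂ), (picardCMUniverse hHD hI h₁ h₃).PeriodNV ι₁ V F f.psi σ := by
  refine exists_periodNV_free_of_jointThetaPin_meeting hHD hI h₁ h₃ fun F hG h6 f => ?_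
  obtain ⟨ι₁, V, σ, S, T, hT, H, CG, G, SK, SigIdx, SigIdxG, _, _, _, _, _, _, _, _, Siso, hΘ, hg, hr⟩ := h F hG h6 f
  exact ⟨ι₁, V, σ, S, H, CG, G, SK, SigIdx, SigIdxG, _, _, _, _, _, _, _, _, Siso,
    Transposition.Model.translateClosed_heckeFamily_of_liftTranslate (by omega) S hΘ, hg, hr⟩

/-- **The joint theta-pinned MEETING display, every clause package-input-shaped**: per face, DATA `S` [S2], a Sylvester matrix `T, hT`
(a choice), DATA `Siso` [(v-S)], with (1ᴸ) `LiftTranslate` of the four theta-class families [(vi-3)], (2′) C5′ `gen12Meet` at the pinned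
theta sets [(v-g′)] and (3′) C6′ `real34Meet` [(v-r′)]; `hR` = Hom-fullness (a tree theorem on the universe of record).  `HC_CM` is NOT
proved. [folklore] -/
theorem hc_cm_of_jointThetaPin_lift (hHD : exists_isReal_hodgeModel) (hI : hodgePQ_independent_of_hodgeModel)
    (h₁ : BallQuotientUniformised) (h₃ : CMAbelianVarietyRealised) (hR : DeligneMilne1982_Thm_6_20_full)
    (h : ∀ (F : CMField), IsGalois ℚ F → 6 ≤ Module.finrank ℚ F → ∀ f : Face F,
      ∃ (ι₁ : F →+* ℂ) (V : HermSpace3 F ι₁) (σ : F →+* ℂ)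
        (S : FaceThetaSupply (picardCMUniverse hHD hI h₁ h₃) ι₁ V F f.psi σ)
        (T : GL (Fin 3) ℂ) (hT : (T : Matrix (Fin 3) (Fin 3) ℂ)ᴴ * V.Hm.map ι₁ * (T : Matrix (Fin 3) (Fin 3) ℂ) = BallModel.J)
        (H CG G SK SigIdx SigIdxG : Type)
        (_ : NormedAddCommGroup H) (_ : InnerProductSpace ℂ H) (_ : CompleteSpace H)
        (_ : NormedAddCommGroup CG) (_ : NormedSpace ℂ CG) (_ : Group G) (_ : TopologicalSpace G) (_ : TopologicalSpace SK)
        (Siso : Perl34.IsolationSetting H (Lp ℂ 2 V.autMeasure) CG G SK SigIdx SigIdxG),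
        (∀ i : Fin 4, Transposition.Model.LiftTranslate hHD hI h₁ h₃ (S.Theta i) T hT) ∧
        (∀ (Γ : Level V) (ω₁ ω₂ : (picardCMUniverse hHD hI h₁ h₃).CohC ((picardCMUniverse hHD hI h₁ h₃).pms F ι₁ V Γ) 1),
          ω₁ ∈ S.Theta 0 Γ → ω₂ ∈ S.Theta 1 Γ →
          embOf hHD hI (ballQuotientUniformisedDatum_of h₁) h₃ Γ
              ((picardCMUniverse hHD hI h₁ h₃).cup2C ((picardCMUniverse hHD hI h₁ h₃).pms F ι₁ V Γ) 1 ω₁ ω₂) ≠ 0 →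
            ∃ u ∈ Siso.t12.S12,
              ⟪embOf hHD hI (ballQuotientUniformisedDatum_of h₁) h₃ Γ
                  ((picardCMUniverse hHD hI h₁ h₃).cup2C ((picardCMUniverse hHD hI h₁ h₃).pms F ι₁ V Γ) 1 ω₁ ω₂), u⟫_ℂ ≠ 0) ∧
        (∀ χ : Siso.t34.X, Siso.t34.allowed χ → ∀ (Φ : SK) (Γ₁ : Level V)
          (ω₁ ω₂ : (picardCMUniverse hHD hI h₁ h₃).CohC ((picardCMUniverse hHD hI h₁ h₃).pms F ι₁ V Γ₁) 1),
          ω₁ ∈ (picardCMUniverse hHD hI h₁ h₃).Uiso Γ₁ F (f.psi 0) σ →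
          ω₂ ∈ (picardCMUniverse hHD hI h₁ h₃).Uiso Γ₁ F (f.psi 1) σ →
            ⟪embOf hHD hI (ballQuotientUniformisedDatum_of h₁) h₃ Γ₁
                ((picardCMUniverse hHD hI h₁ h₃).cup2C ((picardCMUniverse hHD hI h₁ h₃).pms F ι₁ V Γ₁) 1 ω₁ ω₂),
              Siso.t34.ϑ χ Φ⟫_ℂ ≠ 0 →
              ∃ (Γ : Level V) (ω : Fin 4 → (picardCMUniverse hHD hI h₁ h₃).CohC ((picardCMUniverse hHD hI h₁ h₃).pms F ι₁ V Γ) 1),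
                (∀ i, ω i ∈ (picardCMUniverse hHD hI h₁ h₃).Uiso Γ F (f.psi i) σ) ∧
                ⟪embOf hHD hI (ballQuotientUniformisedDatum_of h₁) h₃ Γ
                    ((picardCMUniverse hHD hI h₁ h₃).cup2C ((picardCMUniverse hHD hI h₁ h₃).pms F ι₁ V Γ) 1 (ω 2) (ω 3)),
                  embOf hHD hI (ballQuotientUniformisedDatum_of h₁) h₃ Γ
                    ((picardCMUniverse hHD hI h₁ h₃).cup2C ((picardCMUniverse hHD hI h₁ h₃).pms F ι₁ V Γ) 1 (ω 0) (ω 1))⟫_ℂ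
                  ≠ 0)) :
    HC_CM :=
  hc_cm_of_exists_facePeriod_free hHD hI h₁ h₃ (exists_periodNV_free_of_jointThetaPin_lift hHD hI h₁ h₃ h) hR

/-- **The LIFT-form joint MEETING display on the universe OF RECORD — ONE hypothesis** (the four `_holds` data and
`deligneMilne1982_Thm_6_20_full_holds` plugged in; `let U := U_rec`, `let hU := …` for legibility): per face `S` [theta supply], `T, hT`
[a choice], `Siso` [(v-S)], (1ᴸ) `LiftTranslate` [(vi-3)], (2′) C5′ [(v-g′)], (3′) C6′ [(v-r′)] — each shaped like ONE input of the package's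
`nonempty_thetaRealisation₂_at`.  `HC_CM` is NOT proved: the hypothesis is open at a general face. [folklore] -/
theorem hc_cm_of_jointThetaPin_lift_rec :
    let U := picardCMUniverse exists_isReal_hodgeModel_holds hodgePQ_independent_of_hodgeModel_holds
      BallQuotient.ballQuotientUniformised_holds cmAbelianVarietyRealised_holds
    let hU := ballQuotientUniformisedDatum_of BallQuotient.ballQuotientUniformised_holds
    (∀ (F : CMField), IsGalois ℚ F → 6 ≤ Module.finrank ℚ F → ∀ f : Face F,
      ∃ (ι₁ : F →+* ℂ) (V : HermSpace3 F ι₁) (σ : F →+* ℂ)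
        (S : FaceThetaSupply U ι₁ V F f.psi σ)
        (T : GL (Fin 3) ℂ) (hT : (T : Matrix (Fin 3) (Fin 3) ℂ)ᴴ * V.Hm.map ι₁ * (T : Matrix (Fin 3) (Fin 3) ℂ) = BallModel.J)
        (H CG G SK SigIdx SigIdxG : Type)
        (_ : NormedAddCommGroup H) (_ : InnerProductSpace ℂ H) (_ : CompleteSpace H)
        (_ : NormedAddCommGroup CG) (_ : NormedSpace ℂ CG) (_ : Group G) (_ : TopologicalSpace G) (_ : TopologicalSpace SK)
        (Siso : Perl34.IsolationSetting H (Lp ℂ 2 V.autMeasure) CG G SK SigIdx SigIdxG),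
        (∀ i : Fin 4, Transposition.Model.LiftTranslate exists_isReal_hodgeModel_holds hodgePQ_independent_of_hodgeModel_holds
          BallQuotient.ballQuotientUniformised_holds cmAbelianVarietyRealised_holds (S.Theta i) T hT) ∧
        (∀ (Γ : Level V) (ω₁ ω₂ : U.CohC (U.pms F ι₁ V Γ) 1), ω₁ ∈ S.Theta 0 Γ → ω₂ ∈ S.Theta 1 Γ →
          embOf exists_isReal_hodgeModel_holds hodgePQ_independent_of_hodgeModel_holds hU cmAbelianVarietyRealised_holds Γ
              (U.cup2C (U.pms F ι₁ V Γ) 1 ω₁ ω₂) ≠ 0 →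
            ∃ u ∈ Siso.t12.S12,
              ⟪embOf exists_isReal_hodgeModel_holds hodgePQ_independent_of_hodgeModel_holds hU cmAbelianVarietyRealised_holds Γ
                  (U.cup2C (U.pms F ι₁ V Γ) 1 ω₁ ω₂), u⟫_ℂ ≠ 0) ∧
        (∀ χ : Siso.t34.X, Siso.t34.allowed χ → ∀ (Φ : SK) (Γ₁ : Level V) (ω₁ ω₂ : U.CohC (U.pms F ι₁ V Γ₁) 1),
          ω₁ ∈ U.Uiso Γ₁ F (f.psi 0) σ → ω₂ ∈ U.Uiso Γ₁ F (f.psi 1) σ →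
            ⟪embOf exists_isReal_hodgeModel_holds hodgePQ_independent_of_hodgeModel_holds hU cmAbelianVarietyRealised_holds Γ₁
                (U.cup2C (U.pms F ι₁ V Γ₁) 1 ω₁ ω₂), Siso.t34.ϑ χ Φ⟫_ℂ ≠ 0 →
              ∃ (Γ : Level V) (ω : Fin 4 → U.CohC (U.pms F ι₁ V Γ) 1), (∀ i, ω i ∈ U.Uiso Γ F (f.psi i) σ) ∧
                ⟪embOf exists_isReal_hodgeModel_holds hodgePQ_independent_of_hodgeModel_holds hU cmAbelianVarietyRealised_holds Γ
                    (U.cup2C (U.pms F ι₁ V Γ) 1 (ω 2) (ω 3)),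
                  embOf exists_isReal_hodgeModel_holds hodgePQ_independent_of_hodgeModel_holds hU cmAbelianVarietyRealised_holds Γ
                    (U.cup2C (U.pms F ι₁ V Γ) 1 (ω 0) (ω 1))⟫_ℂ ≠ 0)) →
    HC_CM :=
  fun h ↦ hc_cm_of_jointThetaPin_lift _ _ _ _ deligneMilne1982_Thm_6_20_full_holds h

#print axioms hc_cm_of_jointThetaPin_lift_rec

end Model

end Summit.HodgeConjecture.CorCM

end
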